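import Literature.AlgebraicGeometry.PlaneCurves.HessianCovariance
import Literature.AlgebraicGeometry.PlaneCurves.WeierstrassLineIntersectionCycle
import HarnessLib

/-!
# The chord–tangent recipe under a Weierstrass model: projectivities of a plane cubic that are translations (Artebani–Dolgachev §2; Kunz Cor. 10.7; Knapp Prop. 2.14)

Topic `Literature/AlgebraicGeometry/PlaneCurves`, namespace `Literature.AlgebraicGeometry.PlaneCurves`.
Lane `lit-hodgefound`, seat `lit-hodgefound-p37`, row g21-#5: the GENERIC form of the seat's
"translation principle", so far proved twice for specific models (`HessePencilGroupLaw`, g20-#3: the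
Hesse cubic `H_μ` through `N_μ`, `3 ≠ 0`; `HessePencilCharacteristicThreeTranslation`, g21-#4: `E_t`
through `M_t`, `3 = 0`).  Here the cubic `F`, the substitution `M` and the Weierstrass model `W` are
ARBITRARY subject to `F ∘ M = c·W` (`c ≠ 0`, `det M ≠ 0`, `W` elliptic, `F` a ternary cubic form), on
top of g20-#1 (`WeierstrassLineIntersectionCycle`: Kunz Cor. 10.7 with multiplicities for Mathlib's
`WeierstrassCurve.Affine.Point`) and `HessianCovariance` (`F ∘ M` as `bind₁ M.toMvPolynomial F`, the
evaluation and gradient transport).  Everything here is PROVED; no definition, no named fact.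

Sources, VERBATIM.  M. Artebani, I. Dolgachev, *The Hesse pencil of plane cubic curves*, Enseign.
Math. (2) 55 (2009), §2 [`paper:arxiv-math_0611590` p0004 L5–L6]: "Fixing one of the inflection points
`p₀` defines a commutative group law `⊕` on `E` with `p₀` equal to the zero: `p ⊕ q` is the unique
point `r` such that `p₀, r` and the third point of intersection in `p̄q̄ ∩ E` lie on a line."
E. Kunz, *Introduction to Plane Algebraic Curves* (2005), Ch. 10, Cor. 10.7: for an elliptic curve
with a flex as zero, `P + Q + R = O` iff `P, Q, R` are the intersection cycle of a line.
A. W. Knapp, *Elliptic Curves* (1992), §II.4, Prop. 2.14: a non-singular plane cubic with a flex is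
carried by a projectivity `Φ` with `Φ(flex) = (0, 1, 0)` to a Weierstrass cubic (`F ∘ Φ⁻¹ = c·W`).

## Dictionary

`K` a field; `F ∈ K[X, Y, Z]` homogeneous of degree `3`; `M` an invertible `3 × 3` matrix and `W` a
Mathlib Weierstrass curve with `bind₁ M.toMvPolynomial F = c • W.toProjective.polynomial`, `c ≠ 0`
("`F ∘ M = c·W`"); `vec : W(K) → K³` the coordinate vectors (`vec O = (0,1,0)`, `vec (x,y) = (x,y,1)`,
two hypotheses on a variable, no definition); the point of `F` of `P ∈ W(K)` is `M vec P`, the zero is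
`o = M(0,1,0)`.  A substitution `g` "preserves `F` pointwise" when `F(gp) = F(p)` for all `p`.

## What is here

* §1 transport: `cubic_grad_dotProduct_smul` (`⟨∇F(a·p), q⟩ = a²⟨∇F(p), q⟩`), `eval_model_mulVec`
  (`F(Mv) = c·W(v)`), `grad_model_dotProduct` (`⟨∇F(Mv), Mw⟩ = c·⟨∇W(v), w⟩`), `det_rows_model_mulVec`
  (`det[Ma; Mb; Md] = det M · det[a; b; d]`), **`modelPoint_ne_zero_and_eval`**,
  **`exists_point_of_model`** (every non-zero zero of `F` is `a · M vec P`), **`point_eq_of_modelPoint_smul`**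
  (… for exactly one `P`), `exists_point_image_of_model`.
* §2 **`three_nsmul_eq_zero_of_inflectionTangent_model`**: if the tangent to `F` at `τ` meets `F` only
  at `τ` and `T` lies over `τ`, then `3T = O`.
* §3 **`translation_principle_of_model`**: for substitutions `g, σ` preserving `F` pointwise (`det ≠ 0`,
  `σ² = 1`), `τ` with `T` over it (`3T = O`, `στ ∥ τ`), the incidences `det[p; τ; σp] = 0` and
  `det[o; σp; gp] = 0` for all `p` and the tangency/degeneracy clauses of the coincident cases: for all
  `P, Q ∈ W(K)`, `M vec Q ∥ g(M vec P)` iff `Q = P + T` — `g` is the translation by `T`.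
* §4 **`negation_principle_of_model`**: for `g` preserving `F` pointwise (`det ≠ 0`) with
  `det[o; p; gp] = 0` for all `p` and the tangency clauses: `M vec Q ∥ g(M vec P)` iff `Q = −P`.

## References
* [ArtebaniDolgachev2009] M. Artebani, I. Dolgachev, *The Hesse pencil of plane cubic curves*,
  Enseign. Math. (2) 55 (2009) 235–273, §2 (the group law with zero a flex).
* [Kunz2005PlaneAlgebraicCurves] E. Kunz, *Introduction to Plane Algebraic Curves*, Birkhäuser 2005,
  Ch. 10, Cor. 10.7.
* [Knapp1992] A. W. Knapp, *Elliptic Curves*, Princeton 1992, §II.4, Prop. 2.14.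
-/

set_option autoImplicit false

open MvPolynomial Matrix
open Literature.AlgebraicGeometry.HyperbolicPolynomials

namespace Literature.AlgebraicGeometry.PlaneCurves

universe u

section ModelTransport

variable {K : Type u} [Field K]

/-! ## §1 Transport along a model `F ∘ M = c·W` -/

/-- Scalars in a row of a `3 × 3` determinant. [folklore] -/
private theorem det_rows_smul_model (a : K) (p q r : Fin 3 → K) :
    (Matrix.of ![p, a • q, r]).det = a * (Matrix.of ![p, q, r]).det ∧
      (Matrix.of ![p, q, a • r]).det = a * (Matrix.of ![p, q, r]).det ∧
      (Matrix.of ![a • p, q, r]).det = a * (Matrix.of ![p, q, r]).det := by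
  refine ⟨?_, ?_, ?_⟩ <;>
  · rw [Matrix.det_fin_three, Matrix.det_fin_three]
    simp
    ring

/-- **Scaling a point of a cubic**: for `F` homogeneous of degree `3`, `⟨∇F(a·p), q⟩ = a²·⟨∇F(p), q⟩`
(the partials are quadratic forms). [cite: Knapp1992, §II.4 (homogeneous coordinates, Prop. 2.14)] -/
theorem cubic_grad_dotProduct_smul {F : MvPolynomial (Fin 3) K} (hF : F.IsHomogeneous 3) (a : K)
    (p q : Fin 3 → K) :
    (fun i => eval (a • p) (pderiv i F)) ⬝ᵥ q = a ^ 2 * ((fun i => eval p (pderiv i F)) ⬝ᵥ q) := by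
  simp only [dotProduct, Finset.mul_sum]
  refine Finset.sum_congr rfl fun i _ => ?_
  have h : (pderiv i F).IsHomogeneous 2 := hF.pderiv
  rw [h.eval_smul_eq]
  ring

/-- **Evaluation transport**: `F(Mv) = c·W(v)` when `F ∘ M = c·W`. [cite: Knapp1992, §II.4, Prop. 2.14] -/
theorem eval_model_mulVec {F : MvPolynomial (Fin 3) K} {M : Matrix (Fin 3) (Fin 3) K} {c : K}
    {W : WeierstrassCurve K} (hFM : bind₁ M.toMvPolynomial F = c • W.toProjective.polynomial)
    (v : Fin 3 → K) :
    eval (M *ᵥ v) F = c * eval v W.toProjective.polynomial := by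
  rw [← eval_bind₁_toMvPolynomial, hFM, smul_eval]

/-- **Tangent transport**: `⟨∇F(Mv), Mw⟩ = c·⟨∇W(v), w⟩` when `F ∘ M = c·W`
(`HessianCovariance.grad_bind₁_toMvPolynomial_dotProduct`). [cite: Knapp1992, §II.4, Prop. 2.14] -/
theorem grad_model_dotProduct {F : MvPolynomial (Fin 3) K} {M : Matrix (Fin 3) (Fin 3) K} {c : K}
    {W : WeierstrassCurve K} (hFM : bind₁ M.toMvPolynomial F = c • W.toProjective.polynomial)
    (v w : Fin 3 → K) :
    (fun i => eval (M *ᵥ v) (pderiv i F)) ⬝ᵥ (M *ᵥ w) =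
      c * ((fun j => eval v (pderiv j W.toProjective.polynomial)) ⬝ᵥ w) := by
  rw [← grad_bind₁_toMvPolynomial_dotProduct, hFM]
  simp only [dotProduct, smul_eq_C_mul, pderiv_C_mul, map_mul, eval_C, Finset.mul_sum]
  exact Finset.sum_congr rfl fun j _ => by ring

/-- **Collinearity transport**: `det[Ma; Mb; Md] = det M · det[a; b; d]`. [cite: Knapp1992, §II.4,
Prop. 2.14 (projectivities carry lines to lines)] -/
theorem det_rows_model_mulVec (M : Matrix (Fin 3) (Fin 3) K) (a b d : Fin 3 → K) :
    (Matrix.of ![M *ᵥ a, M *ᵥ b, M *ᵥ d]).det = M.det * (Matrix.of ![a, b, d]).det := by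
  rw [Matrix.det_fin_three, Matrix.det_fin_three, Matrix.det_fin_three]
  simp [Matrix.mulVec, dotProduct, Fin.sum_univ_three]
  ring

variable {F : MvPolynomial (Fin 3) K} {M : Matrix (Fin 3) (Fin 3) K} {c : K} {W : WeierstrassCurve K}
  (vec : W.toAffine.Point → Fin 3 → K)

/-- **Every point of `W(K)` gives a point of `F`**: `M vec P ≠ 0` and `F(M vec P) = 0` (`det M ≠ 0`,
`F ∘ M = c·W`). [cite: Knapp1992, §II.4, Prop. 2.14] -/
theorem modelPoint_ne_zero_and_eval (hFM : bind₁ M.toMvPolynomial F = c • W.toProjective.polynomial)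
    (hM : M.det ≠ 0) (hv0 : vec 0 = ![0, 1, 0])
    (hvs : ∀ x y (h : W.toAffine.Nonsingular x y), vec (.some x y h) = ![x, y, 1])
    (P : W.toAffine.Point) : M *ᵥ vec P ≠ 0 ∧ eval (M *ᵥ vec P) F = 0 := by
  constructor
  · intro h
    have h' : vec P = 0 := by
      have := congrArg (fun w => M⁻¹ *ᵥ w) h
      simp only [Matrix.mulVec_mulVec, Matrix.nonsing_inv_mul _ (isUnit_iff_ne_zero.2 hM),
        Matrix.one_mulVec, Matrix.mulVec_zero] at this
      exact this
    rcases P with _ | ⟨x, y, h⟩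
    · rw [← WeierstrassCurve.Affine.Point.zero_def, hv0] at h'
      simpa using congrFun h' 1
    · rw [hvs] at h'
      simpa using congrFun h' 2
  · rw [eval_model_mulVec hFM]
    rcases P with _ | ⟨x, y, h⟩
    · rw [← WeierstrassCurve.Affine.Point.zero_def, hv0]
      have : eval ![(0 : K), 1, 0] W.toProjective.polynomial = 0 := WeierstrassCurve.Projective.equation_zero
      rw [this, mul_zero]
    · rw [hvs]
      have : eval ![x, y, 1] W.toProjective.polynomial = 0 :=
        (WeierstrassCurve.Projective.equation_some x y).2 h.1
      rw [this, mul_zero]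

/-- **Every point of `F` comes from a point of `W(K)`** (`W` elliptic, `c ≠ 0`, `det M ≠ 0`): a vector
`p ≠ 0` with `F(p) = 0` is `a · M vec P`, `a ≠ 0`. [cite: Knapp1992, §II.4, Prop. 2.14]
[cite: ArtebaniDolgachev2009, §2 (Lemma 1: the Weierstrass form of a plane cubic)] -/
theorem exists_point_of_model [W.IsElliptic]
    (hFM : bind₁ M.toMvPolynomial F = c • W.toProjective.polynomial) (hc : c ≠ 0) (hM : M.det ≠ 0)
    (hv0 : vec 0 = ![0, 1, 0])
    (hvs : ∀ x y (h : W.toAffine.Nonsingular x y), vec (.some x y h) = ![x, y, 1])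
    {p : Fin 3 → K} (hp : p ≠ 0) (hF : eval p F = 0) :
    ∃ (P : W.toAffine.Point) (a : K), a ≠ 0 ∧ p = a • (M *ᵥ vec P) := by
  set v : Fin 3 → K := M⁻¹ *ᵥ p with hv
  have hMv : M *ᵥ v = p := by
    rw [hv, Matrix.mulVec_mulVec, Matrix.mul_nonsing_inv _ (isUnit_iff_ne_zero.2 hM), Matrix.one_mulVec]
  have hvne : v ≠ 0 := fun h => hp (by rw [← hMv, h, Matrix.mulVec_zero])
  have hWv : W.toProjective.Equation v := by
    have h := eval_model_mulVec hFM v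
    rw [hMv, hF] at h
    exact (mul_eq_zero.1 h.symm).resolve_left hc
  by_cases hz : v 2 = 0
  · have hx : v 0 = 0 :=
      (pow_eq_zero_iff three_ne_zero).1 ((WeierstrassCurve.Projective.equation_of_Z_eq_zero hz).1 hWv)
    have hv1 : v 1 ≠ 0 := by
      intro h1; apply hvne
      funext i; fin_cases i
      · exact hx
      · exact h1
      · exact hz
    refine ⟨0, v 1, hv1, ?_⟩
    rw [hv0, ← Matrix.mulVec_smul, ← hMv]
    congr 1
    funext i; fin_cases i <;> simp [hx, hz]
  · have heq : W.toAffine.Equation (v 0 / v 2) (v 1 / v 2) :=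
      (WeierstrassCurve.Projective.equation_of_Z_ne_zero hz).1 hWv
    have hns : W.toAffine.Nonsingular (v 0 / v 2) (v 1 / v 2) :=
      (WeierstrassCurve.Affine.equation_iff_nonsingular (W := W.toAffine)).1 heq
    refine ⟨.some _ _ hns, v 2, hz, ?_⟩
    rw [hvs, ← Matrix.mulVec_smul, ← hMv]
    congr 1
    funext i; fin_cases i
    · simp; rw [mul_div_assoc', mul_div_cancel_left₀ _ hz]
    · simp; rw [mul_div_assoc', mul_div_cancel_left₀ _ hz]
    · simp

/-- **… and from exactly one**: if `M vec P = a · M vec Q` then `P = Q` (`det M ≠ 0`).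
[cite: Knapp1992, §II.4, Prop. 2.14] -/
theorem point_eq_of_modelPoint_smul (hM : M.det ≠ 0) (hv0 : vec 0 = ![0, 1, 0])
    (hvs : ∀ x y (h : W.toAffine.Nonsingular x y), vec (.some x y h) = ![x, y, 1])
    {P Q : W.toAffine.Point} {a : K} (h : M *ᵥ vec P = a • (M *ᵥ vec Q)) : P = Q := by
  have h' : vec P = a • vec Q := by
    have := congrArg (fun w => M⁻¹ *ᵥ w) h
    simp only [Matrix.mulVec_mulVec, Matrix.mulVec_smul,
      Matrix.nonsing_inv_mul _ (isUnit_iff_ne_zero.2 hM), Matrix.one_mulVec] at this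
    exact this
  rcases P with _ | ⟨x, y, hP⟩ <;> rcases Q with _ | ⟨x', y', hQ⟩
  · rfl
  · rw [← WeierstrassCurve.Affine.Point.zero_def, hv0, hvs] at h'
    have e2 : (0 : K) = a * 1 := by simpa using congrFun h' 2
    have e1 : (1 : K) = a * y' := by simpa using congrFun h' 1
    rw [mul_one] at e2
    rw [← e2, zero_mul] at e1
    exact absurd e1 one_ne_zero
  · rw [← WeierstrassCurve.Affine.Point.zero_def, hv0, hvs] at h'
    have e2 : (1 : K) = a * 0 := by simpa using congrFun h' 2
    rw [mul_zero] at e2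
    exact absurd e2 one_ne_zero
  · rw [hvs, hvs] at h'
    have e2 : (1 : K) = a * 1 := by simpa using congrFun h' 2
    have ha : a = 1 := by rw [mul_one] at e2; exact e2.symm
    have e0 : x = a * x' := by simpa using congrFun h' 0
    have e1 : y = a * y' := by simpa using congrFun h' 1
    rw [ha, one_mul] at e0 e1
    subst e0; subst e1; rfl

/-- The point of `F` given by a matrix image: for `g` preserving `F` pointwise with `det g ≠ 0` and
`P ∈ W(K)` there is `Q` with `g(M vec P) = a · M vec Q`. [cite: ArtebaniDolgachev2009, §4 (a
projective transformation preserving the cubic acts on its points)] -/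
theorem exists_point_image_of_model [W.IsElliptic]
    (hFM : bind₁ M.toMvPolynomial F = c • W.toProjective.polynomial) (hc : c ≠ 0) (hM : M.det ≠ 0)
    (hv0 : vec 0 = ![0, 1, 0])
    (hvs : ∀ x y (h : W.toAffine.Nonsingular x y), vec (.some x y h) = ![x, y, 1])
    {g : Matrix (Fin 3) (Fin 3) K} (hg : ∀ p : Fin 3 → K, eval (g *ᵥ p) F = eval p F)
    (hgdet : g.det ≠ 0) (P : W.toAffine.Point) :
    ∃ (Q : W.toAffine.Point) (a : K), a ≠ 0 ∧ g *ᵥ (M *ᵥ vec P) = a • (M *ᵥ vec Q) := by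
  obtain ⟨hne, hev⟩ := modelPoint_ne_zero_and_eval vec hFM hM hv0 hvs P
  refine exists_point_of_model vec hFM hc hM hv0 hvs ?_ (by rw [hg, hev])
  intro h0
  apply hne
  have := congrArg (fun w => g⁻¹ *ᵥ w) h0
  rwa [Matrix.mulVec_mulVec, Matrix.nonsing_inv_mul _ (isUnit_iff_ne_zero.2 hgdet),
    Matrix.one_mulVec, Matrix.mulVec_zero] at this

/-! ## §2 Flexes over base vectors are `3`-torsion -/

/-- **An inflection tangent meeting `F` only at its flex gives a `3`-torsion point**: if every zero `q`
of `F` on the tangent at `τ` is proportional to `τ` and `T ∈ W(K)` lies over `τ` (`M vec T = a_T·τ`),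
then `3T = O` (g20-#1 `weierstrass_tangent_meets_only_iff`, transported).
[cite: ArtebaniDolgachev2009, §2 ("the set of inflection points is the group of 3-torsion points")]
[cite: Kunz2005PlaneAlgebraicCurves, Ch. 10, Cor. 10.7] -/
theorem three_nsmul_eq_zero_of_inflectionTangent_model [DecidableEq K] (hF : F.IsHomogeneous 3)
    (hFM : bind₁ M.toMvPolynomial F = c • W.toProjective.polynomial) (hM : M.det ≠ 0)
    (hv0 : vec 0 = ![0, 1, 0])
    (hvs : ∀ x y (h : W.toAffine.Nonsingular x y), vec (.some x y h) = ![x, y, 1])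
    {τ : Fin 3 → K}
    (hτ : ∀ q : Fin 3 → K, eval q F = 0 → (fun i => eval τ (pderiv i F)) ⬝ᵥ q = 0 → ∃ a : K, q = a • τ)
    {T : W.toAffine.Point} {aT : K} (haT : aT ≠ 0) (hT : M *ᵥ vec T = aT • τ) : 3 • T = 0 := by
  refine (weierstrass_tangent_meets_only_iff _ vec hv0 hvs T).1 fun Q hQ => ?_
  obtain ⟨hq, hqF⟩ := modelPoint_ne_zero_and_eval vec hFM hM hv0 hvs Q
  have h1 : (fun i => eval (M *ᵥ vec T) (pderiv i F)) ⬝ᵥ (M *ᵥ vec Q) = 0 := by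
    rw [grad_model_dotProduct hFM, hQ, mul_zero]
  rw [hT, cubic_grad_dotProduct_smul hF, mul_eq_zero] at h1
  have h2 := h1.resolve_left (pow_ne_zero 2 haT)
  obtain ⟨a, ha⟩ := hτ _ hqF h2
  refine point_eq_of_modelPoint_smul vec hM hv0 hvs (a := a * aT⁻¹) ?_
  rw [ha, hT, smul_smul, mul_assoc, inv_mul_cancel₀ haT, mul_one]

/-! ## §3 The translation principle -/

/-- **The printed recipe for `p ⊕ t`, under a Weierstrass model — a projectivity that is a
translation.**  Let `F ∘ M = c·W` (`F` a cubic form, `c ≠ 0`, `det M ≠ 0`, `W` elliptic), `o = M(0,1,0)`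
the zero, `g, σ` substitutions preserving `F` pointwise (`det ≠ 0`, `σ² = 1`), `τ` a vector with the
point `T ∈ W(K)` over it (`M vec T = a_T·τ`), `3T = O`, `στ ∥ τ`, and suppose for every `p`:
`det[p; τ; σp] = 0` and `det[o; σp; gp] = 0` ("`p ⊕ q` is the unique point `r` such that `p₀, r` and
the third point of intersection in `p̄q̄ ∩ E` lie on a line", with `q = τ`, third point `σp`, `r = gp`),
together with the tangency/degeneracy clauses of the coincident cases.  Then for all `P, Q ∈ W(K)`:
`M vec Q ∥ g(M vec P)` iff `Q = P + T`.  (Kunz Cor. 10.7 with multiplicities, g20-#1, applied to both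
lines: `P + T + S = O`, `O + S + Q = O`.) [cite: ArtebaniDolgachev2009, §2 (the group law with zero a
flex)] [cite: Kunz2005PlaneAlgebraicCurves, Ch. 10, Cor. 10.7] [cite: Knapp1992, §II.4, Prop. 2.14] -/
theorem translation_principle_of_model [DecidableEq K] [W.IsElliptic] (hF : F.IsHomogeneous 3)
    (hFM : bind₁ M.toMvPolynomial F = c • W.toProjective.polynomial) (hc : c ≠ 0) (hM : M.det ≠ 0)
    (hv0 : vec 0 = ![0, 1, 0])
    (hvs : ∀ x y (h : W.toAffine.Nonsingular x y), vec (.some x y h) = ![x, y, 1])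
    {g σ : Matrix (Fin 3) (Fin 3) K} (hg : ∀ p : Fin 3 → K, eval (g *ᵥ p) F = eval p F)
    (hgdet : g.det ≠ 0) (hσ : ∀ p : Fin 3 → K, eval (σ *ᵥ p) F = eval p F)
    (hσdet : σ.det ≠ 0) (hσσ : σ * σ = 1)
    {τ : Fin 3 → K} {T : W.toAffine.Point} {aT : K} (haT : aT ≠ 0)
    (hT : M *ᵥ vec T = aT • τ) (h3T : 3 • T = 0)
    (hστ : ∃ e : K, σ *ᵥ τ = e • τ)
    (hdet1 : ∀ p : Fin 3 → K, (Matrix.of ![p, τ, σ *ᵥ p]).det = 0)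
    (hdet2 : ∀ p : Fin 3 → K, (Matrix.of ![M *ᵥ ![0, 1, 0], σ *ᵥ p, g *ᵥ p]).det = 0)
    (hcoin1 : ∀ p : Fin 3 → K, p ≠ 0 → eval p F = 0 → ∀ a : K, σ *ᵥ p = a • p →
      (fun i => eval p (pderiv i F)) ⬝ᵥ τ = 0 ∨ ∃ d : K, p = d • τ)
    (hcoin2 : ∀ p : Fin 3 → K, p ≠ 0 → eval p F = 0 → ∀ a : K, σ *ᵥ p = a • (g *ᵥ p) →
      (fun i => eval (σ *ᵥ p) (pderiv i F)) ⬝ᵥ (M *ᵥ ![0, 1, 0]) = 0 ∨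
        ∃ d : K, σ *ᵥ p = d • (M *ᵥ ![0, 1, 0]))
    (hS0 : ∀ (p : Fin 3 → K) (a : K), σ *ᵥ p = a • (M *ᵥ ![0, 1, 0]) →
      ∃ d : K, g *ᵥ p = d • (M *ᵥ ![0, 1, 0]))
    (hQ0 : ∀ (p : Fin 3 → K) (a : K), a ≠ 0 → g *ᵥ p = a • (M *ᵥ ![0, 1, 0]) →
      ∃ d : K, σ *ᵥ p = d • (M *ᵥ ![0, 1, 0]))
    (P Q : W.toAffine.Point) :
    (∃ a : K, a ≠ 0 ∧ g *ᵥ (M *ᵥ vec P) = a • (M *ᵥ vec Q)) ↔ Q = P + T := by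
  have hM0 : M *ᵥ ![0, 1, 0] = M *ᵥ vec 0 := by rw [hv0]
  have euler : ∀ R : W.toAffine.Point,
      (fun j => eval (vec R) (pderiv j W.toProjective.polynomial)) ⬝ᵥ vec R = 0 :=
    fun R => (weierstrass_grad_dotProduct_eq_zero_iff _ vec hv0 hvs R R).2 (Or.inl rfl)
  have uniq : ∀ {R R' : W.toAffine.Point} {a b : K}, a ≠ 0 →
      a • (M *ᵥ vec R) = b • (M *ᵥ vec R') → R = R' := by
    intro R R' a b ha hab
    refine point_eq_of_modelPoint_smul vec hM hv0 hvs (a := a⁻¹ * b) ?_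
    rw [← smul_smul, ← hab, smul_smul, inv_mul_cancel₀ ha, one_smul]
  have key : ∀ Q : W.toAffine.Point,
      (∃ a : K, a ≠ 0 ∧ g *ᵥ (M *ᵥ vec P) = a • (M *ᵥ vec Q)) → Q = P + T := by
    rintro Q ⟨a, ha, haQ⟩
    obtain ⟨hp, hpF⟩ := modelPoint_ne_zero_and_eval vec hFM hM hv0 hvs P
    obtain ⟨S, cs, hcs, hS⟩ := exists_point_image_of_model vec hFM hc hM hv0 hvs hσ hσdet P
    -- Step 1: `P + T + S = O`
    have hsum1 : P + T + S = 0 := by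
      refine weierstrass_add_add_eq_zero_of_intersectionCycle _ vec hv0 hvs ?_ ?_ ?_ ?_ ?_
      · have h1 := hdet1 (M *ᵥ vec P)
        have h2 : (Matrix.of ![M *ᵥ vec P, M *ᵥ vec T, σ *ᵥ (M *ᵥ vec P)]).det = 0 := by
          rw [hT, (det_rows_smul_model aT _ _ _).1, h1, mul_zero]
        rw [hS, (det_rows_smul_model cs _ _ _).2.1, det_rows_model_mulVec] at h2
        rcases mul_eq_zero.1 h2 with h2 | h2
        · exact absurd h2 hcs
        · exact (mul_eq_zero.1 h2).resolve_left hM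
      · rintro rfl
        obtain ⟨e, he⟩ := hστ
        have hSP : S = P := by
          refine uniq (R := S) (R' := P) (a := cs) (b := e) hcs ?_
          rw [← hS, hT, Matrix.mulVec_smul, he, smul_smul, smul_smul, mul_comm]
        rw [hSP]; exact euler P
      · rintro rfl
        rcases hcoin1 _ hp hpF cs hS with h | ⟨d, hd⟩
        · have h' : (fun i => eval (M *ᵥ vec P) (pderiv i F)) ⬝ᵥ (M *ᵥ vec T) = 0 := by
            rw [hT, dotProduct_smul, h, smul_zero]
          rw [grad_model_dotProduct hFM, mul_eq_zero] at h'
          exact h'.resolve_left hc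
        · have hd0 : d ≠ 0 := by rintro rfl; exact hp (by rw [hd, zero_smul])
          have hPT : P = T := uniq (R := P) (R' := T) (a := aT) (b := d) haT
            (by rw [hd, hT, smul_smul, smul_smul, mul_comm])
          subst hPT; exact euler P
      · rintro rfl
        obtain ⟨e, he⟩ := hστ
        have hPT : P = T := by
          refine uniq (a := (1 : K)) (b := cs * e) one_ne_zero ?_
          have e1 : M *ᵥ vec P = σ *ᵥ (σ *ᵥ (M *ᵥ vec P)) := by
            rw [Matrix.mulVec_mulVec, hσσ, Matrix.one_mulVec]
          have e2 : τ = aT⁻¹ • (M *ᵥ vec T) := by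
            rw [hT, smul_smul, inv_mul_cancel₀ haT, one_smul]
          rw [one_smul, e1, hS, Matrix.mulVec_smul, hT, Matrix.mulVec_smul, he, e2]
          simp only [smul_smul]
          congr 1
          field_simp
        subst hPT; exact euler P
      · rintro rfl _; exact h3T
    -- Step 2: `O + S + Q = O`
    have hsum2 : (0 : W.toAffine.Point) + S + Q = 0 := by
      refine weierstrass_add_add_eq_zero_of_intersectionCycle _ vec hv0 hvs ?_ ?_ ?_ ?_ ?_
      · have h1 := hdet2 (M *ᵥ vec P)
        rw [hS, haQ, hM0, (det_rows_smul_model cs _ _ _).1, (det_rows_smul_model a _ _ _).2.1,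
          det_rows_model_mulVec] at h1
        rcases mul_eq_zero.1 h1 with h1 | h1
        · exact absurd h1 hcs
        rcases mul_eq_zero.1 h1 with h1 | h1
        · exact absurd h1 ha
        · exact (mul_eq_zero.1 h1).resolve_left hM
      · rintro h0S
        obtain ⟨d, hd⟩ := hS0 _ (cs * 1) (by rw [hS, ← h0S, hM0, mul_one])
        have hd0 : d ≠ 0 := by
          rintro rfl
          rw [zero_smul] at hd
          rw [hd] at haQ
          exact (modelPoint_ne_zero_and_eval vec hFM hM hv0 hvs Q).1
            ((smul_eq_zero.1 haQ.symm).resolve_left ha)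
        have hQ : Q = 0 := uniq (a := a) (b := d) ha (by rw [← haQ, hd, hM0])
        rw [hQ]; exact euler 0
      · rintro h0Q
        obtain ⟨d, hd⟩ := hQ0 _ a ha (by rw [haQ, ← h0Q, hM0])
        have hd0 : d ≠ 0 := by
          rintro rfl
          rw [zero_smul] at hd
          rw [hd] at hS
          exact (modelPoint_ne_zero_and_eval vec hFM hM hv0 hvs S).1
            ((smul_eq_zero.1 hS.symm).resolve_left hcs)
        have hS' : S = 0 := uniq (a := cs) (b := d) hcs (by rw [← hS, hd, hM0])
        rw [hS']; exact euler 0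
      · intro hSQ
        subst hSQ
        have hpar : σ *ᵥ (M *ᵥ vec P) = (cs * a⁻¹) • (g *ᵥ (M *ᵥ vec P)) := by
          rw [hS, haQ, smul_smul, mul_assoc, inv_mul_cancel₀ ha, mul_one]
        rcases hcoin2 _ hp hpF _ hpar with h | ⟨d, hd⟩
        · rw [hS, cubic_grad_dotProduct_smul hF, hM0, grad_model_dotProduct hFM, mul_eq_zero,
            mul_eq_zero] at h
          rcases h with h | h | h
          · exact absurd h (pow_ne_zero 2 hcs)
          · exact absurd h hc
          · exact h
        · have hS' : S = 0 := uniq (a := cs) (b := d) hcs (by rw [← hS, hd, hM0])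
          subst hS'; exact euler 0
      · intro _ _; simp
    rw [zero_add] at hsum2
    rw [eq_neg_of_add_eq_zero_right hsum2, eq_neg_of_add_eq_zero_right hsum1, neg_neg]
  refine ⟨key Q, fun hQ => ?_⟩
  obtain ⟨Q', a, ha, haQ'⟩ := exists_point_image_of_model vec hFM hc hM hv0 hvs hg hgdet P
  rw [hQ, ← key Q' ⟨a, ha, haQ'⟩]
  exact ⟨a, ha, haQ'⟩

/-! ## §4 The negation principle -/

/-- **A projectivity that is the negation.**  Let `F ∘ M = c·W` as above, `o = M(0,1,0)` the zero and
`g` a substitution preserving `F` pointwise (`det g ≠ 0`) such that `o, p, gp` are collinear for every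
`p` ("the third point of the line through the zero"), with the tangency/degeneracy clauses of the
coincident cases (`gp ∥ p`: the tangent at `p` passes through `o` or `p ∥ o`; `g o ∥ o`).  Then for all
`P, Q ∈ W(K)`: `M vec Q ∥ g(M vec P)` iff `Q = −P`.  (Kunz Cor. 10.7 with multiplicities applied to the
line through `o`: `O + P + Q = O`.) [cite: ArtebaniDolgachev2009, §2 (the group law with zero a flex)]
[cite: Kunz2005PlaneAlgebraicCurves, Ch. 10, Cor. 10.7] -/
theorem negation_principle_of_model [DecidableEq K] [W.IsElliptic]
    (hFM : bind₁ M.toMvPolynomial F = c • W.toProjective.polynomial) (hc : c ≠ 0) (hM : M.det ≠ 0)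
    (hv0 : vec 0 = ![0, 1, 0])
    (hvs : ∀ x y (h : W.toAffine.Nonsingular x y), vec (.some x y h) = ![x, y, 1])
    {g : Matrix (Fin 3) (Fin 3) K} (hg : ∀ p : Fin 3 → K, eval (g *ᵥ p) F = eval p F)
    (hgdet : g.det ≠ 0)
    (hgo : ∃ e : K, g *ᵥ (M *ᵥ ![0, 1, 0]) = e • (M *ᵥ ![0, 1, 0]))
    (hdet : ∀ p : Fin 3 → K, (Matrix.of ![M *ᵥ ![0, 1, 0], p, g *ᵥ p]).det = 0)
    (hcoin : ∀ p : Fin 3 → K, p ≠ 0 → eval p F = 0 → ∀ a : K, g *ᵥ p = a • p →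
      (fun i => eval p (pderiv i F)) ⬝ᵥ (M *ᵥ ![0, 1, 0]) = 0 ∨ ∃ d : K, p = d • (M *ᵥ ![0, 1, 0]))
    (hP0 : ∀ (p : Fin 3 → K) (a : K), a ≠ 0 → g *ᵥ p = a • (M *ᵥ ![0, 1, 0]) →
      ∃ d : K, p = d • (M *ᵥ ![0, 1, 0]))
    (P Q : W.toAffine.Point) :
    (∃ a : K, a ≠ 0 ∧ g *ᵥ (M *ᵥ vec P) = a • (M *ᵥ vec Q)) ↔ Q = -P := by
  have hM0 : M *ᵥ ![0, 1, 0] = M *ᵥ vec 0 := by rw [hv0]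
  have euler : ∀ R : W.toAffine.Point,
      (fun j => eval (vec R) (pderiv j W.toProjective.polynomial)) ⬝ᵥ vec R = 0 :=
    fun R => (weierstrass_grad_dotProduct_eq_zero_iff _ vec hv0 hvs R R).2 (Or.inl rfl)
  have uniq : ∀ {R R' : W.toAffine.Point} {a b : K}, a ≠ 0 →
      a • (M *ᵥ vec R) = b • (M *ᵥ vec R') → R = R' := by
    intro R R' a b ha hab
    refine point_eq_of_modelPoint_smul vec hM hv0 hvs (a := a⁻¹ * b) ?_
    rw [← smul_smul, ← hab, smul_smul, inv_mul_cancel₀ ha, one_smul]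
  have key : ∀ Q : W.toAffine.Point,
      (∃ a : K, a ≠ 0 ∧ g *ᵥ (M *ᵥ vec P) = a • (M *ᵥ vec Q)) → Q = -P := by
    rintro Q ⟨a, ha, haQ⟩
    obtain ⟨hp, hpF⟩ := modelPoint_ne_zero_and_eval vec hFM hM hv0 hvs P
    have hsum : (0 : W.toAffine.Point) + P + Q = 0 := by
      refine weierstrass_add_add_eq_zero_of_intersectionCycle _ vec hv0 hvs ?_ ?_ ?_ ?_ ?_
      · have h1 := hdet (M *ᵥ vec P)
        rw [haQ, hM0, (det_rows_smul_model a _ _ _).2.1, det_rows_model_mulVec] at h1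
        rcases mul_eq_zero.1 h1 with h1 | h1
        · exact absurd h1 ha
        · exact (mul_eq_zero.1 h1).resolve_left hM
      · -- `O = P`: `g o ∥ o` so `Q = O`
        rintro h0P
        obtain ⟨e, he⟩ := hgo
        have he0 : e ≠ 0 := by
          rintro rfl
          rw [zero_smul, hM0, h0P, haQ] at he
          exact (modelPoint_ne_zero_and_eval vec hFM hM hv0 hvs Q).1
            ((smul_eq_zero.1 he).resolve_left ha)
        have hQ : Q = 0 := uniq (a := a) (b := e) ha (by rw [← haQ, ← h0P, ← hM0, he])
        rw [hQ]; exact euler 0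
      · -- `O = Q`: `g p ∥ o` forces `p ∥ o`, `P = O`
        rintro h0Q
        obtain ⟨d, hd⟩ := hP0 _ a ha (by rw [haQ, ← h0Q, hM0])
        have hP : P = 0 := by
          refine uniq (a := (1 : K)) (b := d) one_ne_zero ?_
          rw [one_smul, hd, hM0]
        rw [hP]; exact euler 0
      · -- `P = Q`: `g p ∥ p`
        intro hPQ
        subst hPQ
        rcases hcoin _ hp hpF a haQ with h | ⟨d, hd⟩
        · rw [hM0, grad_model_dotProduct hFM, mul_eq_zero] at h
          exact h.resolve_left hc
        · have hP : P = 0 := uniq (a := (1 : K)) (b := d) one_ne_zero (by rw [one_smul, hd, hM0])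
          subst hP; exact euler 0
      · intro _ _; simp
    rw [zero_add] at hsum
    exact eq_neg_of_add_eq_zero_right hsum
  refine ⟨key Q, fun hQ => ?_⟩
  obtain ⟨Q', a, ha, haQ'⟩ := exists_point_image_of_model vec hFM hc hM hv0 hvs hg hgdet P
  rw [hQ, ← key Q' ⟨a, ha, haQ'⟩]
  exact ⟨a, ha, haQ'⟩

end ModelTransport

end Literature.AlgebraicGeometry.PlaneCurves
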